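import Mathlib
import Summits.Ventures.Crystal3D.Theorems.StickyWulffConstantLayerChainDefs
import HarnessLib

/-!
# Outer facet certificates for the sections of the truncated octahedron `W_0` (BLUEPRINT L3 for
# stub `stub_sliceDomination` of line `LayerChain`, crux `StackingLiminf`, stmt-Ventures-19145)

Route `StickyWulffConstant` of the venture `Summits/Ventures/Crystal3D` (cell `crystal3d-full`).
Over the landed vocabulary `StickyWulffConstantLayerChainDefs` (`stackPhi`, `stackWulff`,
`stackSlice`, `dot3`, `aVec`, `bPlus`, `bMinus`; p473239): at `f = 0` the cell function is
`τ`-free, `Φ_0(n) = ∑|n·aᵢ| + ∑|n·b⁺ᵢ|`, and for the facet normals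
`n_ν = (ν_x, ν_u √3/3, ν_Z √6/2)` of the truncated octahedron `W_0` all its values are rational
(cf-p2 R19 `BLUEPRINT-sliceDomination.md` §3 L3).  Writing the height as `y = √(2/3)·Z`, the six
active facets of each chamber `|Z| ≤ 1`, `1 ≤ Z ≤ 3`, `−3 ≤ Z ≤ −1` confine the section
`stackSlice 0 y` to an explicit TENT WINDOW
`{p | a ≤ p.2 ≤ b, |p.1| ≤ P − (√3/3)|p.2 − c|}` (physical coordinates; scaled data
`lo, hi, m, P` of the blueprint table times `√3`), and the two cap facets make it EMPTY for
`|Z| > 3` (`|y| > √6`).  Together with the tent-window area lemma this is the OUTER half of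
slice domination (`volume (stackSlice 0 y) ≤ √3·A_0(Z)`).
WHAT THIS IS NOT: the inner half (vertex certificates of `W_f`), slice domination itself, or
anything about the crux; rung F-C1 not moved.
-/

noncomputable section

namespace Summit.Ventures.Crystal3D.Theorems

open Set
open Summit.Ventures.Crystal3D.LayerChain

/-- `dot3` of two vector literals. -/
theorem dot3_vec3 (a b c d e g : ℝ) : dot3 ![a, b, c] ![d, e, g] = a * d + b * e + c * g := by
  simp [dot3]

/-- At `f = 0` the cell function is `τ`-free: `Φ_0(n, τ) = ∑|n·aᵢ| + ∑|n·b⁺ᵢ|`. -/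
theorem stackPhi_zero_eq (n : Fin 3 → ℝ) (τ : ℝ) :
    stackPhi 0 n τ = (∑ i : Fin 3, |dot3 n (aVec i)|) + ∑ i : Fin 3, |dot3 n (bPlus i)| := by
  simp [stackPhi]

/-- The value of `Φ_0` at the scaled normal `n_ν = (ν_x, ν_u √3/3, ν_Z √6/2)` (rational in `ν`). -/
theorem stackPhi_zero_facet (νx νu νZ τ : ℝ) :
    stackPhi 0 ![νx, νu * (Real.sqrt 3 / 3), νZ * (Real.sqrt 6 / 2)] τ =
      (|νx| + |νx / 2 + νu / 2| + |-(νx / 2) + νu / 2|) +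
        (|νx / 2 + νu / 6 + νZ| + |-(νx / 2) + νu / 6 + νZ| + |-(νu / 3) + νZ|) := by
  have h3 : Real.sqrt 3 * Real.sqrt 3 = 3 := Real.mul_self_sqrt (by norm_num)
  have h6 : Real.sqrt 6 * Real.sqrt (2 / 3) = 2 := by
    rw [← Real.sqrt_mul (by norm_num)]
    rw [show (6 : ℝ) * (2 / 3) = 2 ^ 2 by norm_num, Real.sqrt_sq (by norm_num)]
  have e1 : dot3 ![νx, νu * (Real.sqrt 3 / 3), νZ * (Real.sqrt 6 / 2)] (aVec 0) = νx := by
    simp only [dot3, aVec, Fin.isValue, Matrix.cons_val_zero, Matrix.cons_val_one, Matrix.cons_val_two, Matrix.head_cons, Matrix.tail_cons]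
    ring
  have e2 : dot3 ![νx, νu * (Real.sqrt 3 / 3), νZ * (Real.sqrt 6 / 2)] (aVec 1) =
      νx / 2 + νu / 2 := by
    simp only [dot3, aVec, Fin.isValue, Matrix.cons_val_zero, Matrix.cons_val_one, Matrix.cons_val_two, Matrix.head_cons, Matrix.tail_cons]
    linear_combination (νu / 6) * h3
  have e3 : dot3 ![νx, νu * (Real.sqrt 3 / 3), νZ * (Real.sqrt 6 / 2)] (aVec 2) =
      -(νx / 2) + νu / 2 := by
    simp only [dot3, aVec, Fin.isValue, Matrix.cons_val_zero, Matrix.cons_val_one, Matrix.cons_val_two, Matrix.head_cons, Matrix.tail_cons]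
    linear_combination (νu / 6) * h3
  have e4 : dot3 ![νx, νu * (Real.sqrt 3 / 3), νZ * (Real.sqrt 6 / 2)] (bPlus 0) =
      νx / 2 + νu / 6 + νZ := by
    simp only [dot3, bPlus, Fin.isValue, Matrix.cons_val_zero, Matrix.cons_val_one, Matrix.cons_val_two, Matrix.head_cons, Matrix.tail_cons]
    linear_combination (νu / 18) * h3 + (νZ / 2) * h6
  have e5 : dot3 ![νx, νu * (Real.sqrt 3 / 3), νZ * (Real.sqrt 6 / 2)] (bPlus 1) =
      -(νx / 2) + νu / 6 + νZ := by
    simp only [dot3, bPlus, Fin.isValue, Matrix.cons_val_zero, Matrix.cons_val_one, Matrix.cons_val_two, Matrix.head_cons, Matrix.tail_cons]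
    linear_combination (νu / 18) * h3 + (νZ / 2) * h6
  have e6 : dot3 ![νx, νu * (Real.sqrt 3 / 3), νZ * (Real.sqrt 6 / 2)] (bPlus 2) =
      -(νu / 3) + νZ := by
    simp only [dot3, bPlus, Fin.isValue, Matrix.cons_val_zero, Matrix.cons_val_one, Matrix.cons_val_two, Matrix.head_cons, Matrix.tail_cons]
    linear_combination (-(νu / 9)) * h3 + (νZ / 2) * h6
  rw [stackPhi_zero_eq]
  simp only [Fin.sum_univ_three, e1, e2, e3, e4, e5, e6]

/-- A facet inequality of `W_0` read on the section at height `y = √(2/3)·Z`: for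
`p ∈ stackSlice 0 y`, `ν_x p.1 + ν_u (√3/3) p.2 + ν_Z Z ≤ Φ_0(n_ν)`. -/
theorem slice_zero_facet {Z : ℝ} {p : ℝ × ℝ} (hp : p ∈ stackSlice 0 (Real.sqrt (2 / 3) * Z))
    (νx νu νZ : ℝ) :
    νx * p.1 + νu * (Real.sqrt 3 / 3 * p.2) + νZ * Z ≤
      (|νx| + |νx / 2 + νu / 2| + |-(νx / 2) + νu / 2|) +
        (|νx / 2 + νu / 6 + νZ| + |-(νx / 2) + νu / 6 + νZ| + |-(νu / 3) + νZ|) := by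
  have h6 : Real.sqrt 6 * Real.sqrt (2 / 3) = 2 := by
    rw [← Real.sqrt_mul (by norm_num)]
    rw [show (6 : ℝ) * (2 / 3) = 2 ^ 2 by norm_num, Real.sqrt_sq (by norm_num)]
  have h := hp ![νx, νu * (Real.sqrt 3 / 3), νZ * (Real.sqrt 6 / 2)] 0
  rw [stackPhi_zero_facet, dot3_vec3] at h
  have : p.1 * νx + p.2 * (νu * (Real.sqrt 3 / 3)) + Real.sqrt (2 / 3) * Z * (νZ * (Real.sqrt 6 / 2)) =
      νx * p.1 + νu * (Real.sqrt 3 / 3 * p.2) + νZ * Z := by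
    have : Real.sqrt (2 / 3) * Z * (νZ * (Real.sqrt 6 / 2)) = νZ * Z := by
      linear_combination (Z * νZ / 2) * h6
    rw [this]; ring
  linarith [this ▸ h]

/-- Cap facets: the section of `W_0` at height `√(2/3)·Z` is EMPTY for `|Z| > 3` (`|y| > √6`). -/
theorem stackSlice_zero_eq_empty {Z : ℝ} (hZ : 3 < |Z|) :
    stackSlice 0 (Real.sqrt (2 / 3) * Z) = ∅ := by
  ext p
  simp only [mem_empty_iff_false, iff_false]
  intro hp
  have h1 := slice_zero_facet hp 0 0 1
  have h2 := slice_zero_facet hp 0 0 (-1)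
  norm_num at h1 h2
  have : |Z| ≤ 3 := abs_le.2 ⟨by linarith, by linarith⟩
  linarith

/-- Chamber `|Z| ≤ 1`: the section of `W_0` lies in the tent window with scaled data
`lo = −3/2 + Z/6`, `hi = 3/2 + Z/6`, apex `m = −Z/3`, half-width `P = 3` (physical: `× √3`,
slope `√3/3`). -/
theorem stackSlice_zero_subset_mid (Z : ℝ) :
    stackSlice 0 (Real.sqrt (2 / 3) * Z) ⊆
      {p : ℝ × ℝ | Real.sqrt 3 * (-3 / 2 + Z / 6) ≤ p.2 ∧ p.2 ≤ Real.sqrt 3 * (3 / 2 + Z / 6) ∧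
        |p.1| ≤ 3 - Real.sqrt 3 / 3 * |p.2 - Real.sqrt 3 * (-(Z / 3))|} := by
  intro p hp
  have h3 : Real.sqrt 3 * Real.sqrt 3 = 3 := Real.mul_self_sqrt (by norm_num)
  have hs : 0 < Real.sqrt 3 := Real.sqrt_pos.2 (by norm_num)
  have f1 := slice_zero_facet hp 0 (-6) 1
  have f2 := slice_zero_facet hp 0 6 (-1)
  have f3 := slice_zero_facet hp 3 (-3) (-1)
  have f4 := slice_zero_facet hp (-3) (-3) (-1)
  have f5 := slice_zero_facet hp 3 3 1
  have f6 := slice_zero_facet hp (-3) 3 1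
  norm_num at f1 f2 f3 f4 f5 f6
  refine ⟨?_, ?_, ?_⟩
  · nlinarith [f1, h3, hs]
  · nlinarith [f2, h3, hs]
  · rw [abs_le]
    rcases le_total 0 (p.2 - Real.sqrt 3 * (-(Z / 3))) with h | h
    · rw [abs_of_nonneg h]
      constructor <;> nlinarith [f3, f4, f5, f6, h3, hs]
    · rw [abs_of_nonpos h]
      constructor <;> nlinarith [f3, f4, f5, f6, h3, hs]

/-- Chamber `1 ≤ Z ≤ 3`: scaled data `lo = −3/2 + Z/6`, `hi = 2 − Z/3`, `m = −1/2 + Z/6`,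
`P = 7/2 − Z/2`. -/
theorem stackSlice_zero_subset_top (Z : ℝ) :
    stackSlice 0 (Real.sqrt (2 / 3) * Z) ⊆
      {p : ℝ × ℝ | Real.sqrt 3 * (-3 / 2 + Z / 6) ≤ p.2 ∧ p.2 ≤ Real.sqrt 3 * (2 - Z / 3) ∧
        |p.1| ≤ (7 / 2 - Z / 2) - Real.sqrt 3 / 3 * |p.2 - Real.sqrt 3 * (-1 / 2 + Z / 6)|} := by
  intro p hp
  have h3 : Real.sqrt 3 * Real.sqrt 3 = 3 := Real.mul_self_sqrt (by norm_num)
  have hs : 0 < Real.sqrt 3 := Real.sqrt_pos.2 (by norm_num)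
  have f1 := slice_zero_facet hp 0 (-6) 1
  have f2 := slice_zero_facet hp 0 3 1
  have f3 := slice_zero_facet hp 3 (-3) 2
  have f4 := slice_zero_facet hp (-3) (-3) 2
  have f5 := slice_zero_facet hp 3 3 1
  have f6 := slice_zero_facet hp (-3) 3 1
  norm_num at f1 f2 f3 f4 f5 f6
  refine ⟨?_, ?_, ?_⟩
  · nlinarith [f1, h3, hs]
  · nlinarith [f2, h3, hs]
  · rw [abs_le]
    rcases le_total 0 (p.2 - Real.sqrt 3 * (-1 / 2 + Z / 6)) with h | h
    · rw [abs_of_nonneg h]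
      constructor <;> nlinarith [f3, f4, f5, f6, h3, hs]
    · rw [abs_of_nonpos h]
      constructor <;> nlinarith [f3, f4, f5, f6, h3, hs]

/-- Chamber `−3 ≤ Z ≤ −1`: scaled data `lo = −2 − Z/3`, `hi = 3/2 + Z/6`, `m = 1/2 + Z/6`,
`P = 7/2 + Z/2`. -/
theorem stackSlice_zero_subset_bot (Z : ℝ) :
    stackSlice 0 (Real.sqrt (2 / 3) * Z) ⊆
      {p : ℝ × ℝ | Real.sqrt 3 * (-2 - Z / 3) ≤ p.2 ∧ p.2 ≤ Real.sqrt 3 * (3 / 2 + Z / 6) ∧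
        |p.1| ≤ (7 / 2 + Z / 2) - Real.sqrt 3 / 3 * |p.2 - Real.sqrt 3 * (1 / 2 + Z / 6)|} := by
  intro p hp
  have h3 : Real.sqrt 3 * Real.sqrt 3 = 3 := Real.mul_self_sqrt (by norm_num)
  have hs : 0 < Real.sqrt 3 := Real.sqrt_pos.2 (by norm_num)
  have f1 := slice_zero_facet hp 0 (-3) (-1)
  have f2 := slice_zero_facet hp 0 6 (-1)
  have f3 := slice_zero_facet hp 3 (-3) (-1)
  have f4 := slice_zero_facet hp (-3) (-3) (-1)
  have f5 := slice_zero_facet hp 3 3 (-2)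
  have f6 := slice_zero_facet hp (-3) 3 (-2)
  norm_num at f1 f2 f3 f4 f5 f6
  refine ⟨?_, ?_, ?_⟩
  · nlinarith [f1, h3, hs]
  · nlinarith [f2, h3, hs]
  · rw [abs_le]
    rcases le_total 0 (p.2 - Real.sqrt 3 * (1 / 2 + Z / 6)) with h | h
    · rw [abs_of_nonneg h]
      constructor <;> nlinarith [f3, f4, f5, f6, h3, hs]
    · rw [abs_of_nonpos h]
      constructor <;> nlinarith [f3, f4, f5, f6, h3, hs]

end Summit.Ventures.Crystal3D.Theorems

end
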